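import Summits.BirchSwinnertonDyer.BirchSwinnertonDyer.Theorems.ManinLocalTwoThreeShimuraFiveHelpers
import Mathlib.FieldTheory.Galois.Infinite
import HarnessLib

/-!
# `5 ∣ [Λ₀(f) : Λ₁(f)]` forces `11 ∣ N` — part 2/3: THEOREM A, the Shimura-cover kernel at an odd prime (es g43, road β; MEMO-es §65)

Route `ManinLocalTwoThree`, crux C2 `ManinOddAtFour` stmt-BirchSwinnertonDyer-22967 (helper).

THEOREM A (`smul_eq_self_of_shimuraCover`, any odd prime `p`; the `p = 3` case is E-an-234
`ShimuraCoverKernelGivesMuThree`, `Theorems/ManinLocalTwoThreeShimuraCoverMuThreeHolds.lean`, whose proof this file follows).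
`W₀/ℚ` elliptic with a LATTICE-OPTIMAL `X₀(N)`-datum `D₀`, `D₁` an OPTIMAL `X₁(N)`-datum of an elliptic `W₁` with the same
newform whose Shimura-cover kernel over `Λ₀(f)` is rational, `P ∈ W₁(ℚ)` a kernel point of order `p`, `t ∈ W₀(ℚ)` of order `p`.
Then every `σ ∈ Γ_ℚ` fixing `μ_p` acts trivially on `W₀[p]` (informally `W₀[p] ≅ ℤ/p ⊕ μ_p`).  PROOF.  The isogeny
`ψ : W₁ → W₀` induced on `\bar ℚ`-points (`exists_isogeny_apply_eq_degree_eq_of_forall_mul_mem_lattice`) has Galois-trivial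
kernel on `W₁[p]` (lattice-optimality of `D₀` + rationality of the cover kernel), a line `⟨k⟩` (it is not all of `W₁[p]`: the
Weil pairing `exists_weilPairing_holds` would take a rational value `≠ 1` of odd order `p`); its image `M ≅ W₁[p]/⟨k⟩` is a
Galois-stable line of `W₀[p]` on which `σ` acts by `a(σ)` with `σ(ζ) = ζ^{a(σ)}` for the primitive `p`-th root of unity
`ζ = e_p(k, Q)` — so `M ≅ μ_p` is not pointwise rational (`ζ ∉ ℚ`, `InfiniteGalois.mem_range_algebraMap_iff_fixed`), hence
`M ≠ ⟨t⟩`, `W₀[p] = ⟨t⟩ ⊕ M`, and every `σ` fixing `μ_p` fixes `W₀[p]` pointwise.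

HONEST FRAMING: unconditional tree theorem (standard axioms); no definitions, no named facts, no sorry.  C2, C3, Manin's conjecture
and BSD are NOT proved by this file.
[cite: Vatsal2005, Rem. 1.8] [cite: SilvermanAEC2009, III.8.1] [cite: Stevens1989, §2] [cite: Mazur1977, III.(1.1), Prop. 11.6]
-/

set_option linter.dupNamespace false
set_option autoImplicit false

noncomputable section

open scoped Classical MatrixGroups ModularForm PeriodPair

open CongruenceSubgroup WeierstrassCurve Field Polynomial NumberField IsDedekindDomain IsDedekindDomain.HeightOneSpectrum
  Literature.NumberTheory.EllipticCurves
  Literature.NumberTheory.EllipticCurves.ModularForms Summit.BirchSwinnertonDyer.Rank1Residual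
  Summit.BirchSwinnertonDyer.Rank1Residual.ManinAdditive Summit.BirchSwinnertonDyer.Rank1Residual.ManinAdditive.KatoCurve
  Summit.BirchSwinnertonDyer.Rank1Residual.ManinAdditive.ShimuraCover
  Summit.BirchSwinnertonDyer.BirchSwinnertonDyer.Theorems.ManinLocalTwoThree
  Summit.BirchSwinnertonDyer.BirchSwinnertonDyer.Theorems.ManinLocalTwoThree.CuspGalois
  Summit.BirchSwinnertonDyer.BirchSwinnertonDyer.Theorems.ManinLocalTwoThree.ShimuraCoverHolds

namespace Summit.BirchSwinnertonDyer.BirchSwinnertonDyer.Theorems.ManinLocalTwoThree.ShimuraFive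

/-! ### §2. THEOREM A — the Shimura-cover kernel at an odd prime `p` gives `W₀[p] = ⟨t⟩ ⊕ μ_p` -/

set_option maxHeartbeats 1600000 in
/-- **THEOREM A.**  `W₀/ℚ` elliptic with an `X₀(N)`-datum `D₀` that is lattice-optimal, `D₁` an OPTIMAL `X₁(N)`-datum of an elliptic
`W₁` with the same newform whose Shimura-cover kernel over `Λ₀(f)` is rational (`hrat`), `P ∈ W₁(ℚ)` a kernel point of odd prime
order `p`, and `t ∈ W₀(ℚ)` of order `p`.  Then every `σ ∈ Γ_ℚ` fixing the `p`-th roots of unity acts trivially on `W₀[p]`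
(informally: `W₀[p] ≅ ℤ/p ⊕ μ_p`).  [cite: Vatsal2005, Rem. 1.8] [cite: SilvermanAEC2009, III.8.1] [cite: Stevens1989, §2] -/
theorem smul_eq_self_of_shimuraCover
    (W₀ W₁ : WeierstrassCurve ℚ) [W₀.IsElliptic] [W₁.IsElliptic] {N : ℕ} [NeZero N]
    (D₀ : ModularParametrizationData W₀ N) (D₁ : Gamma1ParametrizationData W₁ N) (hf : D₁.f = D₀.f)
    (hopt : ∀ z ∈ D₀.L.lattice, ∃ w ∈ periodLattice D₀.f, z = D₀.c * w) (hD₁ : D₁.IsOptimal)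
    (hrat : ∀ x ∈ periodLattice D₀.f, ∃ P : (W₁.baseChange ℚ).toAffine.Point,
      Affine.Point.baseChange (W' := W₁) ℚ ℂ P = D₁.uniformize ((D₁.c : ℂ) * x))
    {p : ℕ} (hp : p.Prime) (hp2 : p ≠ 2)
    {x : ℂ} {P : (W₁.baseChange ℚ).toAffine.Point} (hx : x ∈ periodLattice D₀.f)
    (hP : Affine.Point.baseChange (W' := W₁) ℚ ℂ P = D₁.uniformize ((D₁.c : ℂ) * x)) (hPp : addOrderOf P = p)
    {t : (W₀.baseChange ℚ).toAffine.Point} (ht : addOrderOf t = p)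
    (σ : Field.absoluteGaloisGroup ℚ) (hσ : ∀ ζ : AlgebraicClosure ℚ, ζ ^ p = 1 → σ • ζ = ζ)
    (T : W₀.geomTorsion p) : σ • T = T := by
  set Kb := AlgebraicClosure ℚ with hKb
  haveI : Fact p.Prime := ⟨hp⟩
  have hp_odd : Odd p := hp.eq_two_or_odd'.resolve_left hp2
  have hc₀ : (D₀.c : ℂ) ≠ 0 := cast_c_ne_zero_of_latticeOptimal D₀ hopt
  have hc₁ : (D₁.c : ℂ) ≠ 0 := gamma1_cast_c_ne_zero_of_isOptimal D₁ hD₁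
  have hc₀Z : D₀.c ≠ 0 := fun h ↦ hc₀ (by rw [h, Int.cast_zero])
  have hc₁Z : D₁.c ≠ 0 := fun h ↦ hc₁ (by rw [h, Int.cast_zero])
  -- the induced isogeny `ψ : W₁(\bar ℚ) → W₀(\bar ℚ)` (multiplication by `c := c₀/c₁` on `ℂ/Λ(L₁) → ℂ/Λ(L₀)`)
  haveI : Algebra.IsAlgebraic ℚ Kb := AlgebraicClosure.isAlgebraic ℚ
  letI : Algebra Kb ℂ := (IsAlgClosed.lift : Kb →ₐ[ℚ] ℂ).toRingHom.toAlgebra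
  haveI : IsScalarTower ℚ Kb ℂ := IsScalarTower.of_algebraMap_eq' (Subsingleton.elim _ _)
  set j : Kb →ₐ[ℚ] ℂ := IsScalarTower.toAlgHom ℚ Kb ℂ with hj
  have hj₁ : Function.Injective (Affine.Point.map (W' := W₁) j) := Affine.Point.map_injective (W' := W₁) j
  have hj₀ : Function.Injective (Affine.Point.map (W' := W₀) j) := Affine.Point.map_injective (W' := W₀) j
  have hu₀0 : ∀ z, D₀.uniformize z = 0 ↔ z ∈ D₀.L.lattice := fun z ↦ by
    rw [← SetLike.mem_coe, ← D₀.ker_uniformize, SetLike.mem_coe, AddMonoidHom.mem_ker]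
  set c : ℚ := (D₀.c : ℚ) / (D₁.c : ℚ) with hcdef
  have hcne : c ≠ 0 := div_ne_zero (Int.cast_ne_zero.mpr hc₀Z) (Int.cast_ne_zero.mpr hc₁Z)
  have hcC : (c : ℂ) * (D₁.c : ℂ) = (D₀.c : ℂ) := by
    rw [hcdef]; push_cast; field_simp
  have hle : ∀ z ∈ D₁.L.lattice, (c : ℂ) * z ∈ D₀.L.lattice := by
    intro z hz
    obtain ⟨w, hw, rfl⟩ := hD₁ z hz
    have hw₀ : w ∈ periodLattice D₀.f := by
      rw [← hf]; exact periodLatticeGamma1_le_periodLattice D₁.f hw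
    rw [← mul_assoc, hcC]
    exact D₀.smul_periodLattice_le w hw₀
  obtain ⟨ψ, hψ, -⟩ := exists_isogeny_apply_eq_degree_eq_of_forall_mul_mem_lattice
    D₁.isNeronLattice.1 D₁.isNeronLattice.2 D₀.isNeronLattice.1 D₀.isNeronLattice.2
    D₁.uniformize D₁.ker_uniformize D₁.uniformize_surjective D₁.uniformize_spec
    D₀.uniformize D₀.ker_uniformize D₀.uniformize_spec j hcne hle
  -- rational points of `W₁` inside `W₁(\bar ℚ)`
  set ιP : (W₁.baseChange ℚ).toAffine.Point →+ W₁.geomPoints := Affine.Point.baseChange (W' := W₁) ℚ Kb with hιP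
  have hιj : ∀ R, Affine.Point.map (W' := W₁) j (ιP R) = Affine.Point.baseChange (W' := W₁) ℚ ℂ R :=
    fun R ↦ Affine.Point.map_baseChange (W' := W₁) j R
  have hιfix : ∀ (τ : Field.absoluteGaloisGroup ℚ) (R : (W₁.baseChange ℚ).toAffine.Point), τ • ιP R = ιP R := by
    intro τ R
    set τ' : Kb ≃ₐ[ℚ] Kb := τ with hτ'
    change Affine.Point.map (W' := W₁) (τ' : Kb →ₐ[ℚ] Kb) (Affine.Point.baseChange (W' := W₁) ℚ Kb R) = _
    exact Affine.Point.map_baseChange (W' := W₁) (τ' : Kb →ₐ[ℚ] Kb) R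
  have hz₀ : Affine.Point.map (W' := W₀) j (0 : W₀.geomPoints) = 0 := map_zero _
  have hz₁ : Affine.Point.map (W' := W₁) j (0 : W₁.geomPoints) = 0 := map_zero _
  -- a point of `W₁(\bar ℚ)` lying over `u₁(c₁ y)`, `y ∈ Λ₀(f)`, is killed by `ψ`
  have hψker : ∀ (m : W₁.geomPoints) (y : ℂ), y ∈ periodLattice D₀.f →
      Affine.Point.map (W' := W₁) j m = D₁.uniformize ((D₁.c : ℂ) * y) → ψ m = 0 := by
    intro m y hy hm
    apply hj₀
    rw [hψ m _ hm, hz₀, hu₀0, ← mul_assoc, hcC]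
    exact D₀.smul_periodLattice_le y hy
  -- conversely the kernel of `ψ` consists of rational points (uses `hopt` and `hrat`)
  have hkerfix : ∀ m : W₁.geomPoints, ψ m = 0 → ∀ τ : Field.absoluteGaloisGroup ℚ, τ • m = m := by
    intro m hm τ
    obtain ⟨z, hz⟩ := D₁.uniformize_surjective (Affine.Point.map (W' := W₁) j m)
    have h0 : D₀.uniformize ((c : ℂ) * z) = 0 := by rw [← hψ m z hz.symm, hm, hz₀]
    obtain ⟨w, hw, hcw⟩ := hopt _ ((hu₀0 _).mp h0)
    have hzw : z = (D₁.c : ℂ) * w := by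
      have h1 : (c : ℂ) * z = (c : ℂ) * ((D₁.c : ℂ) * w) := by rw [hcw, ← mul_assoc, hcC]
      exact mul_left_cancel₀ (by exact_mod_cast hcne) h1
    obtain ⟨R, hR⟩ := hrat w hw
    have hmR : m = ιP R := hj₁ (by rw [hιj, hR, ← hzw, hz])
    rw [hmR, hιfix]
  -- the kernel point `k := P ∈ W₁[p]`
  set k : W₁.geomPoints := ιP P with hk
  have hkj : Affine.Point.map (W' := W₁) j k = D₁.uniformize ((D₁.c : ℂ) * x) := by rw [hk, hιj, hP]
  have hψk : ψ k = 0 := hψker k x hx hkj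
  have hkp : p • k = 0 := by
    rw [hk, ← map_nsmul, ← hPp, addOrderOf_nsmul_eq_zero, map_zero]
  have hk0 : k ≠ 0 := by
    intro h0
    have hP0 : P = 0 := (map_eq_zero_iff ιP (Affine.Point.map_injective (W' := W₁) _)).mp h0
    rw [hP0, addOrderOf_zero] at hPp
    exact hp.one_lt.ne hPp
  have hsm : ∀ (τ : Field.absoluteGaloisGroup ℚ) (z : Kb), τ • z = (show Kb ≃ₐ[ℚ] Kb from τ) z := fun _ _ ↦ rfl
  have hcard₁ : Nat.card (W₁.geomTorsion p) = p ^ 2 :=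
    card_torsionPoints_eq_sq_holds W₁ (AlgebraicClosure ℚ) (Nat.cast_ne_zero.mpr hp.ne_zero)
  have hcard₀ : Nat.card (W₀.geomTorsion p) = p ^ 2 :=
    card_torsionPoints_eq_sq_holds W₀ (AlgebraicClosure ℚ) (Nat.cast_ne_zero.mpr hp.ne_zero)
  haveI : Finite (W₁.geomTorsion p) := Nat.finite_of_card_ne_zero (by rw [hcard₁]; exact pow_ne_zero 2 hp.ne_zero)
  haveI : Finite (W₀.geomTorsion p) := Nat.finite_of_card_ne_zero (by rw [hcard₀]; exact pow_ne_zero 2 hp.ne_zero)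
  have hkmem : k ∈ W₁.geomTorsion p := AddSubgroup.torsionBy.nsmul_iff.mpr hkp
  set kₚ : W₁.geomTorsion p := ⟨k, hkmem⟩ with hkₚ
  have hkₚ0 : kₚ ≠ 0 := fun h ↦ hk0 (congrArg Subtype.val h)
  have hpkₚ : p • kₚ = 0 := Subtype.ext (by simp [hkₚ, hkp])
  have hσkₚ : ∀ τ : Field.absoluteGaloisGroup ℚ, τ • kₚ = kₚ := fun τ ↦
    Subtype.ext (by rw [AddSubgroup.torsionBy.coe_smul]; exact hkerfix k hψk τ)
  -- `ψ` restricted to the `p`-torsion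
  have hψtors : ∀ S : W₁.geomTorsion p, ψ (S : W₁.geomPoints) ∈ W₀.geomTorsion p := fun S ↦ by
    apply AddSubgroup.torsionBy.nsmul_iff.mpr
    have hS : p • (S : W₁.geomPoints) = 0 := congrArg Subtype.val (AddSubgroup.torsionBy.nsmul S)
    rw [← map_nsmul, hS, map_zero]
  let ψₚ : W₁.geomTorsion p →+ W₀.geomTorsion p :=
    { toFun := fun S ↦ ⟨ψ (S : W₁.geomPoints), hψtors S⟩
      map_zero' := Subtype.ext (by simp)
      map_add' := fun a b ↦ Subtype.ext (by simp) }
  have hψₚ : ∀ S, ((ψₚ S : W₀.geomTorsion p) : W₀.geomPoints) = ψ (S : W₁.geomPoints) := fun S ↦ rfl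
  have hψₚsmul : ∀ (τ : Field.absoluteGaloisGroup ℚ) (S : W₁.geomTorsion p), ψₚ (τ • S) = τ • ψₚ S := fun τ S ↦
    Subtype.ext (by rw [hψₚ, AddSubgroup.torsionBy.coe_smul, ψ.map_smul, AddSubgroup.torsionBy.coe_smul, hψₚ])
  have hψₚk : ψₚ kₚ = 0 := Subtype.ext (by rw [hψₚ]; exact hψk)
  have hKfix : ∀ S : W₁.geomTorsion p, ψₚ S = 0 → ∀ τ : Field.absoluteGaloisGroup ℚ, τ • S = S := fun S hS τ ↦
    Subtype.ext (by rw [AddSubgroup.torsionBy.coe_smul]; exact hkerfix _ (by rw [← hψₚ, hS]; rfl) τ)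
  -- the Weil pairing on `W₁[p]`
  obtain ⟨e₁, hpow₁, haddl₁, haddr₁, hself₁, hnondeg₁, hgal₁⟩ :=
    W₁.exists_weilPairing_holds p hp.two_le (Nat.cast_ne_zero.mpr hp.ne_zero)
  obtain ⟨hne₁, he0l₁, he0r₁, -, hnegr₁, hanti₁⟩ := pairing_basics hp.ne_zero hpow₁ haddl₁ haddr₁ hself₁
  haveI : IsGalois ℚ Kb := @IsAlgClosure.isGalois ℚ Kb _ _ (AlgebraicClosure.instAlgebra ℚ) _ _
  -- (i) `ker ψₚ ≠ W₁[p]`: else `W₁[p]` is Galois-trivial and the Weil pairing takes a rational value `≠ 1` of odd order `p`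
  have hKtop : ψₚ.ker ≠ ⊤ := by
    intro htop
    have hfix : ∀ (τ : Field.absoluteGaloisGroup ℚ) (S : W₁.geomTorsion p), τ • S = S := fun τ S ↦
      hKfix S (by rw [← AddMonoidHom.mem_ker, htop]; exact AddSubgroup.mem_top S) τ
    obtain ⟨S, S', hSS'⟩ : ∃ S S', e₁ S S' ≠ 1 := by
      by_contra hall
      push Not at hall
      have hall0 : ∀ S' : W₁.geomTorsion p, S' = 0 := fun S' ↦ hnondeg₁ S' fun S ↦ hall S S'
      have h1 : Nat.card (W₁.geomTorsion p) = 1 := by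
        rw [Nat.card_eq_one_iff_exists]; exact ⟨0, fun S' ↦ hall0 S'⟩
      rw [hcard₁] at h1
      exact (Nat.one_lt_pow two_ne_zero hp.one_lt).ne' h1
    set ζ' := e₁ S S' with hζ'
    have hζ'fix : ∀ g : Kb ≃ₐ[ℚ] Kb, g ζ' = ζ' := fun g ↦ by
      have h := hgal₁ g S S'
      rw [hfix, hfix, ← hζ'] at h
      exact h
    obtain ⟨q, hq⟩ := (InfiniteGalois.mem_range_algebraMap_iff_fixed ζ').mpr hζ'fix
    have hqp : q ^ p = 1 := by
      have h := hpow₁ S S'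
      rw [← hζ', ← hq, ← map_pow] at h
      exact_mod_cast (algebraMap ℚ Kb).injective (by rw [h, map_one])
    have hq1 := rat_eq_one_of_pow_eq_one_of_odd hp_odd hqp
    rw [hq1, map_one] at hq
    exact hSS' hq.symm
  -- (ii) `ker ψₚ = ⟨kₚ⟩` and `M := im ψₚ` are lines; `M` is Galois-stable
  obtain ⟨hKeq, hKcard⟩ := eq_zmultiples_of_card_eq_sq hp hcard₁ (AddMonoidHom.mem_ker.mpr hψₚk) hkₚ0 hpkₚ hKtop
  obtain ⟨Q, hQ⟩ : ∃ Q : W₁.geomTorsion p, Q ∉ ψₚ.ker := by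
    by_contra hall
    push Not at hall
    exact hKtop ((AddSubgroup.eq_top_iff' _).mpr hall)
  set m₀ : W₀.geomTorsion p := ψₚ Q with hm₀
  have hm₀0 : m₀ ≠ 0 := fun h ↦ hQ (AddMonoidHom.mem_ker.mpr h)
  have hpm₀ : p • m₀ = 0 := by rw [hm₀, ← map_nsmul, AddSubgroup.torsionBy.nsmul, map_zero]
  set M : AddSubgroup (W₀.geomTorsion p) := ψₚ.range with hM
  have hm₀M : m₀ ∈ M := ⟨Q, rfl⟩
  have hMcard : Nat.card M = p := by
    have h1 : ψₚ.ker.index = Nat.card M := AddSubgroup.index_ker ψₚ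
    have h2 : ψₚ.ker.index * Nat.card ψₚ.ker = Nat.card (W₁.geomTorsion p) := AddSubgroup.index_mul_card ψₚ.ker
    rw [h1, hKcard, hcard₁, pow_two] at h2
    exact Nat.eq_of_mul_eq_mul_right hp.pos h2
  have hMtop : M ≠ ⊤ := fun htop ↦ by
    have h := (AddSubgroup.card_eq_iff_eq_top M).mpr htop
    rw [hMcard, hcard₀] at h
    exact hp.one_lt.ne (Nat.eq_of_mul_eq_mul_left hp.pos (by rw [mul_one, ← pow_two]; exact h))
  obtain ⟨hMeq, -⟩ := eq_zmultiples_of_card_eq_sq hp hcard₀ hm₀M hm₀0 hpm₀ hMtop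
  have hMst : ∀ τ : Field.absoluteGaloisGroup ℚ, ∀ a ∈ M, τ • a ∈ M := by
    rintro τ a ⟨S, rfl⟩
    exact ⟨τ • S, hψₚsmul τ S⟩
  -- (iii) `ζ := e_p(kₚ, Q)` is a primitive `p`-th root of unity
  set ζ := e₁ kₚ Q with hζdef
  have hζp : ζ ^ p = 1 := hpow₁ kₚ Q
  have hζ1 : ζ ≠ 1 := by
    intro h1
    let K₁ : AddSubgroup (W₁.geomTorsion p) :=
      { carrier := {X | e₁ kₚ X = 1}
        add_mem' := fun {a b} ha hb ↦ by
          simp only [Set.mem_setOf_eq] at ha hb ⊢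
          rw [haddr₁, ha, hb, one_mul]
        zero_mem' := by simp only [Set.mem_setOf_eq]; exact he0r₁ kₚ
        neg_mem' := fun {a} ha ↦ by
          simp only [Set.mem_setOf_eq] at ha ⊢
          have h := hnegr₁ kₚ a
          rwa [ha, mul_one] at h }
    have hK₁top : K₁ ≠ ⊤ := by
      intro htop
      apply hkₚ0
      refine hnondeg₁ kₚ fun S ↦ ?_
      have hS : e₁ kₚ S = 1 := by
        have : S ∈ K₁ := htop ▸ AddSubgroup.mem_top S
        exact this
      have h := hanti₁ kₚ S
      rwa [hS, one_mul] at h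
    obtain ⟨hK₁eq, -⟩ := eq_zmultiples_of_card_eq_sq hp hcard₁ (show kₚ ∈ K₁ from hself₁ kₚ) hkₚ0 hpkₚ hK₁top
    have hQK : Q ∈ K₁ := h1
    rw [hK₁eq, ← hKeq] at hQK
    exact hQ hQK
  have hζprim : IsPrimitiveRoot ζ p := by
    have hord : orderOf ζ = p := by
      rcases (Nat.dvd_prime hp).mp (orderOf_dvd_of_pow_eq_one hζp) with h | h
      · exact absurd (orderOf_eq_one_iff.mp h) hζ1
      · exact h
    rw [← hord]; exact IsPrimitiveRoot.orderOf ζ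
  have hek : ∀ S ∈ ψₚ.ker, e₁ kₚ S = 1 := by
    intro S hS
    rw [hKeq] at hS
    obtain ⟨n, -, rfl⟩ := exists_nsmul_eq_of_mem_zmultiples hp.pos hpkₚ hS
    rw [pairing_nsmul_right haddr₁ he0r₁, hself₁, one_pow]
  -- (iv) the character of `M`: `τ • m₀ = a • m₀` with `τ(ζ) = ζ ^ a`
  have hkey : ∀ τ : Field.absoluteGaloisGroup ℚ, ∃ a : ℕ, a < p ∧ τ • m₀ = a • m₀ ∧
      (show Kb ≃ₐ[ℚ] Kb from τ) ζ = ζ ^ a := by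
    intro τ
    have hτM : τ • m₀ ∈ AddSubgroup.zmultiples m₀ := by rw [← hMeq]; exact hMst τ m₀ hm₀M
    obtain ⟨a, ha, hτm₀⟩ := exists_nsmul_eq_of_mem_zmultiples hp.pos hpm₀ hτM
    have hS : τ • Q - a • Q ∈ ψₚ.ker := by
      rw [AddMonoidHom.mem_ker, map_sub, hψₚsmul, map_nsmul, ← hm₀, hτm₀, sub_self]
    refine ⟨a, ha, hτm₀, ?_⟩
    have h := hgal₁ τ kₚ Q
    rw [hσkₚ, hsm] at h
    rw [h, show τ • Q = (τ • Q - a • Q) + a • Q by abel, haddr₁, hek _ hS, one_mul,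
      pairing_nsmul_right haddr₁ he0r₁]
  have hfixM_of : ∀ τ : Field.absoluteGaloisGroup ℚ, (show Kb ≃ₐ[ℚ] Kb from τ) ζ = ζ → τ • m₀ = m₀ := by
    intro τ hτζ
    obtain ⟨a, ha, hτm₀, hτζ'⟩ := hkey τ
    rw [hτζ'] at hτζ
    have ha1 : a = 1 := hζprim.pow_inj ha hp.one_lt (by rw [pow_one]; exact hτζ)
    rw [hτm₀, ha1, one_nsmul]
  have hζ_of_fixM : ∀ τ : Field.absoluteGaloisGroup ℚ, τ • m₀ = m₀ → (show Kb ≃ₐ[ℚ] Kb from τ) ζ = ζ := by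
    intro τ hτm
    obtain ⟨a, ha, hτm₀, hτζ'⟩ := hkey τ
    have hord : addOrderOf m₀ = p := addOrderOf_eq_prime hpm₀ hm₀0
    have hmod : a ≡ 1 [MOD p] := by
      rw [← hord]
      exact nsmul_eq_nsmul_iff_modEq.mp (by rw [one_nsmul, ← hτm₀]; exact hτm)
    have ha1 : a = 1 := Nat.ModEq.eq_of_lt_of_lt hmod ha hp.one_lt
    rw [hτζ', ha1, pow_one]
  -- (v) `M` is not pointwise rational (`ζ ∉ ℚ`)
  obtain ⟨τ₀, hτ₀⟩ : ∃ τ : Field.absoluteGaloisGroup ℚ, τ • m₀ ≠ m₀ := by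
    by_contra hall
    push Not at hall
    have hζfix : ∀ g : Kb ≃ₐ[ℚ] Kb, g ζ = ζ := fun g ↦ hζ_of_fixM g (hall g)
    obtain ⟨q, hq⟩ := (InfiniteGalois.mem_range_algebraMap_iff_fixed ζ).mpr hζfix
    have hqp : q ^ p = 1 := by
      have h : ζ ^ p = 1 := hζp
      rw [← hq, ← map_pow] at h
      exact_mod_cast (algebraMap ℚ Kb).injective (by rw [h, map_one])
    have hq1 := rat_eq_one_of_pow_eq_one_of_odd hp_odd hqp
    rw [hq1, map_one] at hq
    exact hζ1 hq.symm
  -- (vi) the rational point `t` of `W₀[p]` is not in `M`, so `W₀[p] = ⟨t⟩ ⊔ M`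
  set ιP₀ : (W₀.baseChange ℚ).toAffine.Point →+ W₀.geomPoints := Affine.Point.baseChange (W' := W₀) ℚ Kb with hιP₀
  have hι₀fix : ∀ (τ : Field.absoluteGaloisGroup ℚ) (R : (W₀.baseChange ℚ).toAffine.Point), τ • ιP₀ R = ιP₀ R := by
    intro τ R
    set τ' : Kb ≃ₐ[ℚ] Kb := τ with hτ'
    change Affine.Point.map (W' := W₀) (τ' : Kb →ₐ[ℚ] Kb) (Affine.Point.baseChange (W' := W₀) ℚ Kb R) = _
    exact Affine.Point.map_baseChange (W' := W₀) (τ' : Kb →ₐ[ℚ] Kb) R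
  set tg : W₀.geomPoints := ιP₀ t with htg
  have htgp : p • tg = 0 := by rw [htg, ← map_nsmul, ← ht, addOrderOf_nsmul_eq_zero, map_zero]
  have htg0 : tg ≠ 0 := by
    intro h0
    have h0' : t = 0 := (map_eq_zero_iff ιP₀ (Affine.Point.map_injective (W' := W₀) _)).mp h0
    rw [h0', addOrderOf_zero] at ht
    exact hp.one_lt.ne ht
  set tₚ : W₀.geomTorsion p := ⟨tg, AddSubgroup.torsionBy.nsmul_iff.mpr htgp⟩ with htₚ
  have htₚ0 : tₚ ≠ 0 := fun h ↦ htg0 (congrArg Subtype.val h)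
  have hptₚ : p • tₚ = 0 := Subtype.ext (by simp [htₚ, htgp])
  have htₚfix : ∀ τ : Field.absoluteGaloisGroup ℚ, τ • tₚ = tₚ := fun τ ↦
    Subtype.ext (by rw [AddSubgroup.torsionBy.coe_smul]; exact hι₀fix τ t)
  have htM : tₚ ∉ M := by
    intro hmem
    obtain ⟨hMeq', -⟩ := eq_zmultiples_of_card_eq_sq hp hcard₀ hmem htₚ0 hptₚ hMtop
    apply hτ₀
    have hm : m₀ ∈ AddSubgroup.zmultiples tₚ := by rw [← hMeq']; exact hm₀M
    obtain ⟨n, -, hn⟩ := exists_nsmul_eq_of_mem_zmultiples hp.pos hptₚ hm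
    rw [hn, smul_nsmul_comm, htₚfix]
  have htop : AddSubgroup.zmultiples tₚ ⊔ M = ⊤ := by
    set H := AddSubgroup.zmultiples tₚ ⊔ M with hH
    have hMle : M ≤ H := le_sup_right
    have htH : tₚ ∈ H := (le_sup_left : AddSubgroup.zmultiples tₚ ≤ H) (AddSubgroup.mem_zmultiples tₚ)
    have hdvd : Nat.card H ∣ p ^ 2 := by rw [← hcard₀]; exact AddSubgroup.card_addSubgroup_dvd_card H
    obtain ⟨i, hi, hi'⟩ := (Nat.dvd_prime_pow hp).mp hdvd
    interval_cases i
    · exfalso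
      have hbot := AddSubgroup.eq_bot_of_card_eq H (by rw [hi', pow_zero])
      rw [hbot, AddSubgroup.mem_bot] at htH
      exact htₚ0 htH
    · exfalso
      have hMH : M = H := AddSubgroup.eq_of_le_of_card_ge hMle (by rw [hi', pow_one, hMcard])
      rw [← hMH] at htH
      exact htM htH
    · exact (AddSubgroup.card_eq_iff_eq_top H).mp (hi'.trans hcard₀.symm)
  -- (vii) conclusion: `σ` fixes `μ_p`, hence `m₀`, `M` and `tₚ`, hence all of `W₀[p]`
  let Fix : AddSubgroup (W₀.geomTorsion p) :=
    { carrier := {X | σ • X = X}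
      add_mem' := fun {a b} ha hb ↦ by
        simp only [Set.mem_setOf_eq] at ha hb ⊢
        rw [smul_add, ha, hb]
      zero_mem' := by simp only [Set.mem_setOf_eq]; exact smul_zero σ
      neg_mem' := fun {a} ha ↦ by
        simp only [Set.mem_setOf_eq] at ha ⊢
        rw [smul_neg, ha] }
  have hσm₀ : σ • m₀ = m₀ := hfixM_of σ (hσ ζ hζp)
  have hMle : M ≤ Fix := by
    rw [hMeq]
    exact (AddSubgroup.zmultiples_le).mpr (show σ • m₀ = m₀ from hσm₀)
  have htle : AddSubgroup.zmultiples tₚ ≤ Fix := (AddSubgroup.zmultiples_le).mpr (show σ • tₚ = tₚ from htₚfix σ)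
  have hle' : AddSubgroup.zmultiples tₚ ⊔ M ≤ Fix := sup_le htle hMle
  rw [htop] at hle'
  have hFix : Fix = ⊤ := top_le_iff.mp hle'
  have hT : T ∈ Fix := hFix ▸ AddSubgroup.mem_top T
  exact hT

end Summit.BirchSwinnertonDyer.BirchSwinnertonDyer.Theorems.ManinLocalTwoThree.ShimuraFive

end
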